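import Summits.Ventures.PackingBounds.ThreePointCert.K7d12Agg1

/-!
# κ(7) ≤ 134: kernel validation of Gram block R2 (chunks 3–3 of 3)

Framing: lottery ticket; floor = certified bounds/negative ranges. Venture `PackingBounds` (cell
`pub-packcert`), three-point SDP family. Integer data of a feasible point of the Bachoc–Vallentin
semidefinite program (n = 7, s = 1/2, degree d = 12, symmetric
sums of squares), derived by `pub-packcert-lp/code/lean3pt/cert2lean_lp.py` from the exact rational certificate
`sdp-d7-deg12-sym-lp-v1.json` of the cell (exact verifier #1 + verifier #2 of the other seat), in the units of the kernel
checker `ThreePointCert.Check` (soundness `ThreePointCert.Sound`/`Soundness`); Gram factors offset-encoded for the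
Kronecker-packed chunk validation `ThreePointCert.CheckKron` (emitter `emitleanK.py`, lp gen 3). Generated file: plain
lists of integers / monomials.
-/

namespace Summit.Ventures.PackingBounds.ThreePointCert.K7d12

open Literature.Geometry.DiscreteGeometry Literature.Geometry.DiscreteGeometry.PolyCert PolyCert.SPoly

set_option maxRecDepth 100000 in
set_option maxHeartbeats 0 in
/-- Block `R2`: rows from 236 ((K7d12.gR2K.z.length - 236) rows) of `zᵀ(LLᵀ)z` added to `dR2c2` give `eR2` (kernel, Kronecker-packed chunk check). -/
theorem okR2_3 : chunkOKK K7d12.gR2K 236 (K7d12.gR2K.z.length - 236) K7d12.dR2c2 K7d12.eR2 = true := by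
  decide +kernel

end Summit.Ventures.PackingBounds.ThreePointCert.K7d12
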